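import Mathlib.Data.Sym.Card
import Mathlib.Data.Fintype.Vector
import Mathlib.Data.Nat.Choose.Bounds
import Summits.ValiantsHypothesis.ValiantsHypothesis.Theorems.LacunarySymmetroidMatrixDescartesCensusTropicalKLaw

/-!
# `MatrixDescartes` — census vocabulary, tropical side, part 3: the SLOPE-COUNTING LAW (tropical Descartes row)

HONEST FRAMING.  Helper of the crux `Summit.ValiantsHypothesis.ValiantsHypothesis.Theses.LacunarySymmetroid.MatrixDescartes`
(ledger item `stmt-ValiantsHypothesis-18050`; object-search cell `pub-symmetroid`, Conjecture-B ideation seat conjb-2,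
2026-08-25), companion of `…CensusTropicalKLaw` (part 1: `TropRootLawAt`, the candidate laws, the thin law).  It proves
ELEMENTARY UPPER BOUNDS for the tropical census row `TropicalCensus.TropRootLawAt m K B` and nothing else: no statement
about `KPlusLogSqLaw`, `MatrixDescartes` or `VP ≠ VNP` is asserted or hypothesised.

Contents (all sorry-free).
* `slope d p = Σᵢ d (λ i)` — the θ-coefficient of `tropWeight d v θ p`; `classSym p : Sym (Fin K) m` — the multiset of
  classes used by the Leibniz term `p = (σ, λ)`; `slope_eq_of_classSym` (the slope depends only on the class multiset).
* `slope_lt_of_dominant` — two DISTINCT terms dominant at slopes `θa < θb` have `slope d p < slope d p'` (add the two strict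
  optimality inequalities).  Hence along a chain of dominant terms with alternating signs the class multisets are pairwise
  distinct, and
* `tropRootLawAt_slopeCount : TropRootLawAt m K (Nat.multichoose K m − 1)` — the TROPICAL DESCARTES ROW, twin of the real
  row `Census.posRootLawAt_descartes m K : PosRootLawAt m K (C(m+K−1, m) − 1)` (same count: monomials of degree `m` in `K`
  variables); `tropRootLawAt_choose` (the same bound as a binomial coefficient).
* WINDOW LOCALISATION of the tropical `K + log² m` question: `tropRootLawAt_fatEnd` (`m ≤ K ⇒ T ≤ 2^{2K}`),
  `tropRootLawAt_thinEnd` (`K ≤ log₂ m + 1 ⇒ T ≤ 2^{(log₂ m + 2)·log₂ m}`), `tropRootLawAt_offWindow`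
  (`K ≤ log₂ m + 1 ∨ m ≤ K ⇒ TropRootLawAt m K (2^{3 (K + log₂² m)})`): OUTSIDE the window `log₂ m + 1 < K < m` the
  candidate law `TropKPlusLogSqLaw` holds with `C = 3` by counting alone; its content is the window, where counting gives
  `log₂ T ≤ K·log₂(e·m/K)` and the law asks for `C·(K + log₂² m)`.
-/

set_option linter.dupNamespace false
set_option autoImplicit false

namespace Summit.ValiantsHypothesis.ValiantsHypothesis.Theorems.LacunarySymmetroidMatrixDescartes.TropicalCensus

open Summit.ValiantsHypothesis.ValiantsHypothesis.Theorems.MatrixDescartes.Negative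
open scoped BigOperators
open Finset

section Slopes

variable {m K : ℕ}

/-- total exponent (slope) of a Leibniz term. -/
def slope (d : Fin K → ℕ) (p : Equiv.Perm (Fin m) × (Fin m → Fin K)) : ℤ := ∑ i, (d (p.2 i) : ℤ)

/-- the class multiset of a term, as an element of `Sym (Fin K) m`. -/
def classSym (p : Equiv.Perm (Fin m) × (Fin m → Fin K)) : Sym (Fin K) m :=
  ⟨(univ : Finset (Fin m)).val.map p.2, by simp⟩

/-- the slope of a term only depends on its class multiset. -/
theorem slope_eq_of_classSym (d : Fin K → ℕ) (p : Equiv.Perm (Fin m) × (Fin m → Fin K)) :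
    slope d p = (((classSym p) : Multiset (Fin K)).map fun l => (d l : ℤ)).sum := by
  unfold slope classSym
  simp only [Sym.coe_mk, Multiset.map_map]
  rfl

/-- **Slopes strictly increase along a dominant chain.** If `p` is the unique optimum at `θa` and `p' ≠ p` the unique
optimum at `θb > θa`, then `slope p < slope p'`. [folklore: convexity of the upper envelope] -/
theorem slope_lt_of_dominant (d : Fin K → ℕ) (v ε : Fin m → Fin m → Fin K → ℤ) {θa θb : ℤ} (hab : θa < θb)
    {p p' : Equiv.Perm (Fin m) × (Fin m → Fin K)} (hne : p ≠ p') (ha : IsDominant d v ε θa p)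
    (hb : IsDominant d v ε θb p') : slope d p < slope d p' := by
  have h1 := ha.2 p' (Ne.symm hne) hb.1
  have h2 := hb.2 p hne ha.1
  unfold tropWeight at h1 h2
  unfold slope
  set S := ∑ i, (d (p.2 i) : ℤ)
  set S' := ∑ i, (d (p'.2 i) : ℤ)
  set V := ∑ i, v (p.1 i) i (p.2 i)
  set V' := ∑ i, v (p'.1 i) i (p'.2 i)
  have h3 : (θb - θa) * (S' - S) > 0 := by nlinarith
  by_contra hcon
  push Not at hcon
  have : (θb - θa) * (S' - S) ≤ 0 := mul_nonpos_of_nonneg_of_nonpos (by linarith) (by linarith)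
  linarith

/-- **SLOPE-COUNTING LAW** (theorem): a dominant sign-alternating chain in format `(m, K)` has at most
`multichoose K m − 1 = C(K+m−1, m) − 1` breakpoints, because the class multisets of its terms are pairwise distinct.
This is the tropical twin of Descartes' bound by the number of monomials of `det F`. [folklore] -/
theorem tropRootLawAt_slopeCount (m K : ℕ) : TropRootLawAt m K (Nat.multichoose K m - 1) := by
  intro d v ε n θ p hε hθ hdom halt
  -- consecutive terms are distinct (their signs multiply to a negative number)
  have hne : ∀ k : Fin n, p k.castSucc ≠ p k.succ := by
    intro k h
    have := halt k
    rw [h] at this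
    exact absurd this (not_lt.mpr (mul_self_nonneg _))
  -- slopes strictly increase
  have hsm : StrictMono fun k => slope d (p k) := by
    rw [Fin.strictMono_iff_lt_succ]
    intro k
    exact slope_lt_of_dominant d v ε (hθ Fin.castSucc_lt_succ) (hne k) (hdom _) (hdom _)
  -- hence the class multisets are pairwise distinct
  have hinj : Function.Injective fun k => classSym (p k) := by
    intro k k' h
    apply hsm.injective
    simp only
    rw [slope_eq_of_classSym, slope_eq_of_classSym]
    exact congrArg (fun M : Sym (Fin K) m => ((M : Multiset (Fin K)).map fun l => (d l : ℤ)).sum) h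
  have hcard := Fintype.card_le_of_injective _ hinj
  rw [Fintype.card_fin, Sym.card_sym_eq_multichoose, Fintype.card_fin] at hcard
  omega

/-- binomial form of the slope-counting law. -/
theorem tropRootLawAt_choose (m K : ℕ) : TropRootLawAt m K ((K + m - 1).choose m - 1) := by
  rw [← Nat.multichoose_eq]; exact tropRootLawAt_slopeCount m K

/-- **Fat end of the window** (theorem): if `m ≤ K` then `T(m,K) ≤ 2^{2K}` — inside `TropKPlusLogSqLaw` with `C = 2`. -/
theorem tropRootLawAt_fatEnd {m K : ℕ} (hmK : m ≤ K) : TropRootLawAt m K (2 ^ (2 * K)) := by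
  refine tropRootLawAt_mono ?_ (tropRootLawAt_choose m K)
  calc (K + m - 1).choose m - 1 ≤ (K + m - 1).choose m := Nat.sub_le _ _
    _ ≤ 2 ^ (K + m - 1) := Nat.choose_le_two_pow _ _
    _ ≤ 2 ^ (2 * K) := Nat.pow_le_pow_right (by norm_num) (by omega)

/-- **Thin end of the window** (theorem): if `K ≤ log₂ m + 1` then `T(m,K) ≤ 2^{(log₂ m + 2)·log₂ m}` — inside
`TropKPlusLogSqLaw` with `C = 3`. -/
theorem tropRootLawAt_thinEnd {m K : ℕ} (hK : K ≤ Nat.log 2 m + 1) :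
    TropRootLawAt m K (2 ^ ((Nat.log 2 m + 2) * Nat.log 2 m)) := by
  rcases Nat.eq_zero_or_pos K with rfl | hKpos
  · -- no classes: at most one term (none if `m > 0`)
    refine tropRootLawAt_mono ?_ (tropRootLawAt_slopeCount m 0)
    rcases m with _ | m
    · simp
    · rw [Nat.multichoose_zero_succ]; simp
  rcases Nat.eq_zero_or_pos m with rfl | hmpos
  · refine tropRootLawAt_mono ?_ (tropRootLawAt_slopeCount 0 K)
    simp
  set L := Nat.log 2 m with hL
  have hm : m < 2 ^ (L + 1) := hL ▸ Nat.lt_pow_succ_log_self (by norm_num) m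
  refine tropRootLawAt_mono ?_ (tropRootLawAt_choose m K)
  have hsymm : (K + m - 1).choose m = (K + m - 1).choose (K - 1) :=
    Nat.choose_symm_of_eq_add (by omega)
  calc (K + m - 1).choose m - 1 ≤ (K + m - 1).choose (K - 1) := by rw [← hsymm]; exact Nat.sub_le _ _
    _ ≤ (K + m - 1) ^ (K - 1) := Nat.choose_le_pow _ _
    _ ≤ (2 ^ (L + 2)) ^ (K - 1) := by
        apply Nat.pow_le_pow_left
        have : K ≤ 2 ^ (L + 1) := by
          calc K ≤ L + 1 := hK
            _ ≤ 2 ^ (L + 1) := Nat.lt_two_pow_self.le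
        calc K + m - 1 ≤ 2 ^ (L + 1) + 2 ^ (L + 1) := by omega
          _ = 2 ^ (L + 2) := by ring
    _ = 2 ^ ((L + 2) * (K - 1)) := by rw [← pow_mul]
    _ ≤ 2 ^ ((L + 2) * L) := Nat.pow_le_pow_right (by norm_num) (Nat.mul_le_mul_left _ (by omega))

/-- **TB off the window** (theorem): outside `log₂ m + 1 < K < m` the tropical `K + log² m` law holds with `C = 3`. -/
theorem tropRootLawAt_offWindow (m K : ℕ) (h : K ≤ Nat.log 2 m + 1 ∨ m ≤ K) :
    TropRootLawAt m K (2 ^ (3 * (K + Nat.log 2 m ^ 2))) := by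
  have hLL : Nat.log 2 m ≤ Nat.log 2 m ^ 2 := Nat.le_self_pow two_ne_zero _
  have hsq : (Nat.log 2 m + 2) * Nat.log 2 m = Nat.log 2 m ^ 2 + 2 * Nat.log 2 m := by ring
  rcases h with h | h
  · refine tropRootLawAt_mono (Nat.pow_le_pow_right (by norm_num) ?_) (tropRootLawAt_thinEnd h)
    omega
  · refine tropRootLawAt_mono (Nat.pow_le_pow_right (by norm_num) ?_) (tropRootLawAt_fatEnd h)
    omega

end Slopes

end Summit.ValiantsHypothesis.ValiantsHypothesis.Theorems.LacunarySymmetroidMatrixDescartes.TropicalCensus
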